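import Mathlib.Tactic
import HarnessLib

/-!
# Kozma–Nitzan's Question 8 — ψ-VISIBILITY and the depth-1 corner condition (Q-A)(δ)₁ for every block (gen 44)

Support file (`--supports stmt-CriticalPhenomena-4575`, closed crux; independent mathematics on Kozma–Nitzan's Question 8,
arXiv:2401.12397 §5.5 p. 36), prover `prim-ineq-gen-6` (gen 44).  No definitions, no named facts, no sorries; standard axioms.
Memo `run/shared/lean/prim/prim-ineq-gen-6/PROOF-PSIVIS-G44.md`.

Root class `0` of a path-end block: root marks `a = A₀`, `g = C₀`, first edge weight `s = s₁`, suffix `T₁` with channels `u₁`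
(C-good, A-bad), `v₁` (A-good, C-bad), `m₁` (both good), `p₀ = Φ(T₁) = u₁ + v₁ + m₁ ≤ 1`; block moments `ε = a(p₀ − su₁)`,
`π = g(p₀ − sv₁)`, `m = ag(p₀ − s(u₁+v₁))`, `Φ = ε + π − m`, `D = ε − m`, `ϖ = πΦ − m`, `cΦ = Dϖ`, `M = M(a,g) = a + g − ag`, and the
level-0 density of class 0, `ψ₀ = y₀ + β₀ = c·p₀·M − ag[(Φ+m)(1−Φ)p₀ − Φ(π+m)(1−p₀)]`.

* `kPsiVis_identity` — the polynomial identity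
  `gΦD·(p₀Ms·u₁ − aΦ(1−p₀)) = Φψ₀ + SLACK − p₀M(cΦ − Dϖ)`,
  `SLACK = Dp₀Mm(1−Φ) + gΦ(Φ+m)·a s(1−g)u₁ + gΦ(1−a)D·[s(av₁ + gu₁) + m + (1−p₀)M n₀]`, `n₀ = (1−s)p₀ + sm₁`;
* `kPsiVis_main` — ψ-VISIBILITY: `ψ₀ > 0 ⟹ aΦ(1−p₀) < s·p₀·M·u₁` (the two-level analogue of (VIS+) of gen 29, which needs `U₀ > 0`);
* `kPsiVis_jointDefect` — the joint-defect class bound `(1−C₁)·u₁ ≤ C₁·(1−p₀)` (classes of `T₁` have C-mark `≤ C₁`);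
* `kPsiVis_F3` — hence `(1−s)·a·(A₁−C₁) ≤ s·C₁` (uses `Φ ≥ (1−s)p₀M`, the class-0 part of `Φ`);
* `kPsiVis_CK1` — with LEMMA Ψ₀ / THEOREM UB (`δ₀ ≤ c·p₀·a·g`): `(A₁−C₁)(1−s)δ₀ ≤ c·gC₁·s·p₀`, i.e. the depth-1 Chebyshev
  constant of the δ-chain is `≤ 1`;
* `kPsiVis_QA1` — (Q-A)(δ) at depth 1: `Pg₁ > 0 ⟹ Qa₁ ≥ −c`, for EVERY block with `ψ₀ > 0` (inflated and lag depth-0 types),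
  closing THEOREM (X1)-A at the first importer `t* = 2` unconditionally (PROOF-DRED-G43 §7(c) had it for `U₀ > 0` only).
[cite: KozmaNitzan2024, Question 8 (§5.5 p. 36)]
-/

namespace Summit.CriticalPhenomena.PercolationContinuityZ3.Theorems

namespace PocketCert

/-- **ψ-VISIBILITY, the exact identity** (free variables `a g s u₁ v₁ m₁ c`; all block moments expanded):
`gΦD(p₀Ms u₁ − aΦ(1−p₀)) = Φψ₀ + SLACK − p₀M(cΦ − Dϖ)`.
[cite: KozmaNitzan2024, Question 8 (§5.5 p. 36)] -/
theorem kPsiVis_identity (a g s u1 v1 m1 c : ℝ) :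
    let p := u1 + v1 + m1
    let M := a + g - a * g
    let pi := g * (p - s * v1)
    let m := a * g * (p - s * (u1 + v1))
    let D := a * ((1 - g) * (p - s * u1) + g * s * v1)
    let Φ := pi + D
    let ϖ := pi * Φ - m
    let ψ0 := c * p * M - a * g * ((Φ + m) * (1 - Φ) * p - Φ * (pi + m) * (1 - p))
    let n0 := (1 - s) * p + s * m1
    let SL := D * p * M * m * (1 - Φ) + g * Φ * (Φ + m) * (a * s * (1 - g) * u1)
      + g * Φ * (1 - a) * D * (s * (a * v1 + g * u1) + m + (1 - p) * M * n0)
    g * Φ * D * (p * M * s * u1 - a * Φ * (1 - p)) = Φ * ψ0 + SL - p * M * (c * Φ - D * ϖ) := by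
  intro p M pi m D Φ ϖ ψ0 n0 SL
  simp only [p, M, pi, m, D, Φ, ϖ, ψ0, n0, SL]
  ring

/-- **ψ-VISIBILITY, named form of the identity** (block moments as named variables bound by their defining equations).
[cite: KozmaNitzan2024, Question 8 (§5.5 p. 36)] -/
theorem kPsiVis_identity_named (a g s u1 v1 m1 c p M pi m D Φ ϖ ψ0 : ℝ)
    (hp : p = u1 + v1 + m1) (hM : M = a + g - a * g) (hpi : pi = g * (p - s * v1)) (hm : m = a * g * (p - s * (u1 + v1)))
    (hD : D = a * ((1 - g) * (p - s * u1) + g * s * v1)) (hΦ : Φ = pi + D) (hϖ : ϖ = pi * Φ - m)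
    (hψ : ψ0 = c * p * M - a * g * ((Φ + m) * (1 - Φ) * p - Φ * (pi + m) * (1 - p))) :
    g * Φ * D * (p * M * s * u1 - a * Φ * (1 - p))
      = Φ * ψ0 + (D * p * M * m * (1 - Φ) + g * Φ * (Φ + m) * (a * s * (1 - g) * u1)
          + g * Φ * (1 - a) * D * (s * (a * v1 + g * u1) + m + (1 - p) * M * ((1 - s) * p + s * m1)))
        - p * M * (c * Φ - D * ϖ) := by
  subst hψ hϖ hΦ hD hm hpi hM hp
  ring

/-- **ψ-VISIBILITY.**  For an admissible root step (`0 ≤ a, g, s ≤ 1`, channels `u₁, v₁, m₁ ≥ 0`, `p₀ = u₁+v₁+m₁ ≤ 1`, `Φ > 0`)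
and `c` with `cΦ = Dϖ`: if `ψ₀ > 0` then `aΦ(1−p₀) < s·p₀·M(a,g)·u₁` — the A-channel of the suffix, weighted by the edge,
dominates the far defect.  (All three summands of `SLACK` are nonnegative and `gΦD ≥ 0`.)
[cite: KozmaNitzan2024, Question 8 (§5.5 p. 36)] -/
theorem kPsiVis_main (a g s u1 v1 m1 c p M pi m D Φ ϖ ψ0 : ℝ)
    (hp : p = u1 + v1 + m1) (hM : M = a + g - a * g) (hpi : pi = g * (p - s * v1)) (hm : m = a * g * (p - s * (u1 + v1)))
    (hD : D = a * ((1 - g) * (p - s * u1) + g * s * v1)) (hΦ : Φ = pi + D) (hϖ : ϖ = pi * Φ - m)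
    (hψ : ψ0 = c * p * M - a * g * ((Φ + m) * (1 - Φ) * p - Φ * (pi + m) * (1 - p)))
    (ha0 : 0 ≤ a) (ha1 : a ≤ 1) (hg0 : 0 ≤ g) (hg1 : g ≤ 1) (hs0 : 0 ≤ s) (hs1 : s ≤ 1)
    (hu : 0 ≤ u1) (hv : 0 ≤ v1) (hm1 : 0 ≤ m1) (hp1 : p ≤ 1) (hΦpos : 0 < Φ)
    (hc : c * Φ = D * ϖ) (hpos : 0 < ψ0) :
    a * Φ * (1 - p) < s * p * M * u1 := by
  -- signs of the building blocks
  have hab : 0 ≤ 1 - a := by linarith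
  have hgb : 0 ≤ 1 - g := by linarith
  have hsu : s * u1 ≤ u1 := mul_le_of_le_one_left hu hs1
  have hsv : s * v1 ≤ v1 := mul_le_of_le_one_left hv hs1
  have hsuv : s * (u1 + v1) ≤ u1 + v1 := mul_le_of_le_one_left (by linarith) hs1
  have hp0 : 0 ≤ p := by rw [hp]; linarith
  have hpsu : 0 ≤ p - s * u1 := by rw [hp]; linarith
  have hpsv : 0 ≤ p - s * v1 := by rw [hp]; linarith
  have hpsuv : 0 ≤ p - s * (u1 + v1) := by rw [hp]; linarith
  have hMpos : 0 ≤ M := by rw [hM]; nlinarith [mul_nonneg ha0 hgb]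
  have hDpos : 0 ≤ D := by
    rw [hD]; exact mul_nonneg ha0 (add_nonneg (mul_nonneg hgb hpsu) (mul_nonneg (mul_nonneg hg0 hs0) hv))
  have hmpos : 0 ≤ m := by rw [hm]; exact mul_nonneg (mul_nonneg ha0 hg0) hpsuv
  -- 1 - Φ ≥ 0 via the closed form
  have h1Φ : 1 - Φ = (1 - p) * (a + g - a * g) + (1 - a) * (1 - g) + s * a * (1 - g) * u1 + s * g * (1 - a) * v1 := by
    rw [hΦ, hD, hpi]; ring
  have hΦ1 : 0 ≤ 1 - Φ := by
    rw [h1Φ]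
    have e1 : 0 ≤ (1 - p) * (a + g - a * g) := mul_nonneg (by linarith) (by nlinarith [mul_nonneg ha0 hgb])
    have e2 : 0 ≤ (1 - a) * (1 - g) := mul_nonneg hab hgb
    have e3 : 0 ≤ s * a * (1 - g) * u1 := mul_nonneg (mul_nonneg (mul_nonneg hs0 ha0) hgb) hu
    have e4 : 0 ≤ s * g * (1 - a) * v1 := mul_nonneg (mul_nonneg (mul_nonneg hs0 hg0) hab) hv
    linarith
  -- the slack is nonnegative
  have hn0 : 0 ≤ (1 - s) * p + s * m1 := add_nonneg (mul_nonneg (by linarith) hp0) (mul_nonneg hs0 hm1)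
  have hSL1 : 0 ≤ D * p * M * m * (1 - Φ) :=
    mul_nonneg (mul_nonneg (mul_nonneg (mul_nonneg hDpos hp0) hMpos) hmpos) hΦ1
  have hSL2 : 0 ≤ g * Φ * (Φ + m) * (a * s * (1 - g) * u1) :=
    mul_nonneg (mul_nonneg (mul_nonneg hg0 hΦpos.le) (by linarith)) (mul_nonneg (mul_nonneg (mul_nonneg ha0 hs0) hgb) hu)
  have hSL3 : 0 ≤ g * Φ * (1 - a) * D * (s * (a * v1 + g * u1) + m + (1 - p) * M * ((1 - s) * p + s * m1)) := by
    apply mul_nonneg (mul_nonneg (mul_nonneg (mul_nonneg hg0 hΦpos.le) hab) hDpos)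
    have e1 : 0 ≤ s * (a * v1 + g * u1) := mul_nonneg hs0 (add_nonneg (mul_nonneg ha0 hv) (mul_nonneg hg0 hu))
    have e2 : 0 ≤ (1 - p) * M * ((1 - s) * p + s * m1) := mul_nonneg (mul_nonneg (by linarith) hMpos) hn0
    linarith
  -- the identity with the block relation cΦ = Dϖ
  have hid := kPsiVis_identity_named a g s u1 v1 m1 c p M pi m D Φ ϖ ψ0 hp hM hpi hm hD hΦ hϖ hψ
  have hcorr : c * Φ - D * ϖ = 0 := by linarith [hc]
  rw [hcorr, mul_zero, sub_zero] at hid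
  have hΦψ : 0 < Φ * ψ0 := mul_pos hΦpos hpos
  have hprod : 0 < g * Φ * D * (p * M * s * u1 - a * Φ * (1 - p)) := by rw [hid]; linarith
  have hgΦD : 0 ≤ g * Φ * D := mul_nonneg (mul_nonneg hg0 hΦpos.le) hDpos
  by_contra hX
  rw [not_lt] at hX
  have : g * Φ * D * (p * M * s * u1 - a * Φ * (1 - p)) ≤ 0 :=
    mul_nonpos_of_nonneg_of_nonpos hgΦD (by linarith)
  linarith

open Finset in
/-- **Joint-defect class bound.**  If `u₁ = Σ_l w_l κ_l` (`w_l = r_l p_l (1−α_l) ≥ 0`, the A-bad mass of class `l` of `T₁`,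
`κ_l = C_[1,l]` its C-mark), every class has `κ_l ≤ C₁` with `C₁ ≥ 0`, and the joint defects are part of the far defect,
`Σ_l w_l (1 − κ_l) ≤ J` (`J = 1 − p₀`), then `(1 − C₁)·u₁ ≤ C₁·J`.  [cite: KozmaNitzan2024, Question 8 (§5.5 p. 36)] -/
theorem kPsiVis_jointDefect {ι : Type*} (L : Finset ι) (w κ : ι → ℝ) (C₁ u1 J : ℝ) (hC : 0 ≤ C₁)
    (hw : ∀ l ∈ L, 0 ≤ w l) (hκ : ∀ l ∈ L, κ l ≤ C₁)
    (hu : u1 = ∑ l ∈ L, w l * κ l) (hJ : ∑ l ∈ L, w l * (1 - κ l) ≤ J) :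
    (1 - C₁) * u1 ≤ C₁ * J := by
  have h1 : (1 - C₁) * u1 ≤ C₁ * ∑ l ∈ L, w l * (1 - κ l) := by
    rw [hu, mul_sum, mul_sum]
    apply sum_le_sum
    intro l hl
    have := hκ l hl
    have hwl := hw l hl
    nlinarith
  have h2 : C₁ * ∑ l ∈ L, w l * (1 - κ l) ≤ C₁ * J := mul_le_mul_of_nonneg_left hJ hC
  linarith

/-- **Two-step form of the joint-defect bound.**  Vertex `1` with marks `(A, C)`, second edge weight `t`, suffix `T₂` with channels
`(u₂, v₂, m₂)`, `p₁ = u₂+v₂+m₂ ≤ 1`; then `u₁ = C(1−A)m̃ + tCu₂`, `v₁ = A(1−C)m̃ + tAv₂`, `m₁ = ACm̃` with `m̃ = (1−t)p₁ + tm₂`, and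
`(1−C)·u₁ ≤ C·(1 − p₀)`, `p₀ = u₁ + v₁ + m₁`.  [cite: KozmaNitzan2024, Question 8 (§5.5 p. 36)] -/
theorem kPsiVis_jointDefect2 (A C t u2 v2 m2 : ℝ) (hA1 : A ≤ 1) (hC0 : 0 ≤ C)
    (ht0 : 0 ≤ t) (hv : 0 ≤ v2) (hp1 : u2 + v2 + m2 ≤ 1) :
    let mt := (1 - t) * (u2 + v2 + m2) + t * m2
    let u1 := C * (1 - A) * mt + t * C * u2
    let v1 := A * (1 - C) * mt + t * A * v2
    let m1 := A * C * mt
    (1 - C) * u1 ≤ C * (1 - (u1 + v1 + m1)) := by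
  intro mt u1 v1 m1
  -- C(1 - p₀) - (1-C)u₁ = C[1 - m̃ - t u₂ - t A v₂] ≥ C[1 - p₁] ≥ 0
  have key : C * (1 - (u1 + v1 + m1)) - (1 - C) * u1 = C * (1 - mt - t * u2 - t * A * v2) := by
    simp only [u1, v1, m1]; ring
  have hmt : mt + t * u2 + t * A * v2 ≤ 1 := by
    simp only [mt]
    have e1 : t * A * v2 ≤ t * v2 := by
      have := mul_le_of_le_one_left hv hA1
      nlinarith
    nlinarith
  nlinarith [mul_nonneg hC0 (by linarith : (0:ℝ) ≤ 1 - mt - t * u2 - t * A * v2)]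

/-- **F3 ≤ 1.**  From ψ-visibility `aΦ(1−p₀) < s p₀ M u₁`, the joint-defect bound `(1−C₁)u₁ ≤ C₁(1−p₀)`, the class-0 part of
`Φ` (`(1−s)p₀M ≤ Φ`), and the signs `a, u₁, C₁ ≥ 0`, `p₀ ≤ 1`, `Φ > 0`, `A₁ ≤ 1`, `0 ≤ s ≤ 1`:
`(1−s)·a·(A₁ − C₁) ≤ s·C₁` (and `u₁ > 0`).  [cite: KozmaNitzan2024, Question 8 (§5.5 p. 36)] -/
theorem kPsiVis_F3 (a Φ p M s u1 A₁ C₁ : ℝ) (hvis : a * Φ * (1 - p) < s * p * M * u1)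
    (hjd : (1 - C₁) * u1 ≤ C₁ * (1 - p)) (hu : 0 ≤ u1) (ha : 0 ≤ a) (hΦ : 0 < Φ) (hA : A₁ ≤ 1) (hC : 0 ≤ C₁)
    (hs0 : 0 ≤ s) (hs1 : s ≤ 1) (hp1 : p ≤ 1) (hfirst : (1 - s) * p * M ≤ Φ) :
    (1 - s) * a * (A₁ - C₁) ≤ s * C₁ := by
  have haΦ : 0 ≤ a * Φ := mul_nonneg ha hΦ.le
  -- u₁ > 0 (else aΦ(1-p) < 0, impossible)
  have hup : 0 < u1 := by
    by_contra h
    have hu0 : u1 = 0 := le_antisymm (not_lt.mp h) hu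
    rw [hu0] at hvis
    have : 0 ≤ a * Φ * (1 - p) := mul_nonneg haΦ (by linarith)
    linarith
  -- aΦ(1-C₁)u₁ ≤ aΦ·C₁(1-p) ≤ C₁·s p M u₁
  have h1 : a * Φ * ((1 - C₁) * u1) ≤ a * Φ * (C₁ * (1 - p)) := mul_le_mul_of_nonneg_left hjd haΦ
  have h2 : C₁ * (a * Φ * (1 - p)) ≤ C₁ * (s * p * M * u1) := mul_le_mul_of_nonneg_left hvis.le hC
  have h3 : a * Φ * (1 - C₁) * u1 ≤ C₁ * s * p * M * u1 := by nlinarith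
  -- divide by u₁ > 0
  have h4 : a * Φ * (1 - C₁) ≤ C₁ * s * p * M := le_of_mul_le_mul_right (by nlinarith) hup
  -- multiply by (1-s) ≥ 0 and use (1-s) p M ≤ Φ
  have h5 : (1 - s) * (a * Φ * (1 - C₁)) ≤ (1 - s) * (C₁ * s * p * M) := mul_le_mul_of_nonneg_left h4 (by linarith)
  have h6 : (1 - s) * (C₁ * s * p * M) ≤ C₁ * s * Φ := by
    have := mul_le_mul_of_nonneg_left hfirst (mul_nonneg hC hs0)
    nlinarith
  have h7 : ((1 - s) * a * (1 - C₁)) * Φ ≤ (s * C₁) * Φ := by nlinarith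
  have h8 : (1 - s) * a * (1 - C₁) ≤ s * C₁ := le_of_mul_le_mul_right h7 hΦ
  -- A₁ - C₁ ≤ 1 - C₁
  have h9 : (1 - s) * a * (A₁ - C₁) ≤ (1 - s) * a * (1 - C₁) :=
    mul_le_mul_of_nonneg_left (by linarith) (mul_nonneg (by linarith) ha)
  linarith

/-- **CK′₁(δ) ≤ 1 in multiplied-out form.**  With LEMMA Ψ₀ / THEOREM UB (`0 ≤ δ₀ ≤ c·p₀·a·g`) and F3 (`(1−s)a(A₁−C₁) ≤ sC₁`):
`(A₁ − C₁)(1−s)δ₀ ≤ c·g·C₁·s·p₀`.  [cite: KozmaNitzan2024, Question 8 (§5.5 p. 36)] -/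
theorem kPsiVis_CK1 (a g s p δ0 c A₁ C₁ : ℝ) (hF3 : (1 - s) * a * (A₁ - C₁) ≤ s * C₁)
    (hδ0 : 0 ≤ δ0) (hδ : δ0 ≤ c * p * a * g) (hc : 0 ≤ c) (hg : 0 ≤ g) (hs0 : 0 ≤ s) (hs1 : s ≤ 1) (hp : 0 ≤ p) (hC : 0 ≤ C₁) :
    (A₁ - C₁) * (1 - s) * δ0 ≤ c * g * C₁ * s * p := by
  rcases le_or_gt A₁ C₁ with hAC | hAC
  · have : (A₁ - C₁) * (1 - s) * δ0 ≤ 0 :=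
      mul_nonpos_of_nonpos_of_nonneg (mul_nonpos_of_nonpos_of_nonneg (by linarith) (by linarith)) hδ0
    have : 0 ≤ c * g * C₁ * s * p := mul_nonneg (mul_nonneg (mul_nonneg (mul_nonneg hc hg) hC) hs0) hp
    linarith
  · have h1 : (A₁ - C₁) * (1 - s) * δ0 ≤ (A₁ - C₁) * (1 - s) * (c * p * a * g) :=
      mul_le_mul_of_nonneg_left hδ (mul_nonneg (by linarith) (by linarith))
    have h2 : (A₁ - C₁) * (1 - s) * (c * p * a * g) = (c * g * p) * ((1 - s) * a * (A₁ - C₁)) := by ring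
    have h3 : (c * g * p) * ((1 - s) * a * (A₁ - C₁)) ≤ (c * g * p) * (s * C₁) :=
      mul_le_mul_of_nonneg_left hF3 (mul_nonneg (mul_nonneg hc hg) hp)
    nlinarith

/-- **(Q-A)(δ) at depth 1.**  Emissions of the two children of a class-2 node: `g₀ = ρ₀δ₀/p₀ > 0` (`ρ₀ = (1−s)/s`) and `g₁ ≤ 0`;
`Pg₁ = g₀/a₀ + g₁/a₁`, `Qa₁ = g₀/γ₀ + g₁/γ₁` with `a₁ = aA₁`, `γ₁ = gC₁` (the sign of `g₁` is not needed).  If `Pg₁ > 0` (depth 1 is a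
δ-A-hypothesis depth) and
`(A₁ − C₁)(1−s)δ₀ ≤ c·gC₁·s·p₀` (`kPsiVis_CK1`), then `Qa₁ ≥ −c`.  [cite: KozmaNitzan2024, Question 8 (§5.5 p. 36)] -/
theorem kPsiVis_QA1 (a g s p δ0 c A₁ C₁ g1 : ℝ) (hCK : (A₁ - C₁) * (1 - s) * δ0 ≤ c * g * C₁ * s * p)
    (ha : 0 < a) (hg : 0 < g) (hA : 0 < A₁) (hC : 0 < C₁) (hs0 : 0 < s) (hs1 : s ≤ 1) (hp : 0 < p) (hδ0 : 0 ≤ δ0)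
    (hyp : 0 < (1 - s) / s * δ0 / p / a + g1 / (a * A₁)) :
    -c ≤ (1 - s) / s * δ0 / p / g + g1 / (g * C₁) := by
  -- write g₀ = ρ₀δ₀/p ; hypothesis: A₁ g₀ + g1 > 0 ; goal: C₁ g₀ + g1 ≥ -c g C₁
  set g0 := (1 - s) / s * δ0 / p with hg0def
  have hg0 : 0 ≤ g0 := by
    rw [hg0def]; exact div_nonneg (mul_nonneg (div_nonneg (by linarith) hs0.le) hδ0) hp.le
  have haA : 0 < a * A₁ := mul_pos ha hA
  have hgC : 0 < g * C₁ := mul_pos hg hC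
  -- hypothesis ⇒ A₁ g0 + g1 > 0
  have hyp' : 0 < A₁ * g0 + g1 := by
    have e : (1 - s) / s * δ0 / p / a + g1 / (a * A₁) = (A₁ * g0 + g1) / (a * A₁) := by
      rw [hg0def]; field_simp
    rw [e] at hyp
    exact (div_pos_iff_of_pos_right haA).mp hyp
  -- CK in g0-units: (A₁ - C₁) g0 ≤ c g C₁
  have hCK' : (A₁ - C₁) * g0 ≤ c * (g * C₁) := by
    have e : (A₁ - C₁) * g0 = ((A₁ - C₁) * (1 - s) * δ0) / (s * p) := by rw [hg0def]; field_simp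
    rw [e, div_le_iff₀ (mul_pos hs0 hp)]
    nlinarith
  -- goal in g0-units: (C₁ g0 + g1)/(g C₁) ≥ -c  ⟸  C₁ g0 + g1 ≥ -c g C₁ ⟸ g1 > -A₁ g0 and (A₁ - C₁) g0 ≤ c g C₁
  have e2 : (1 - s) / s * δ0 / p / g + g1 / (g * C₁) = (C₁ * g0 + g1) / (g * C₁) := by
    rw [hg0def]; field_simp
  rw [e2, le_div_iff₀ hgC]
  nlinarith

end PocketCert

end Summit.CriticalPhenomena.PercolationContinuityZ3.Theorems
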